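import Mathlib.CategoryTheory.Equivalence
import Mathlib.CategoryTheory.Endomorphism
import Literature.AlgebraicGeometry.Frobenioids.CategoriesFactorization
import Literature.AlgebraicGeometry.Frobenioids.Frobenioid
import Literature.AlgebraicGeometry.Frobenioids.ProfiniteUnits
import Literature.AlgebraicGeometry.Frobenioids.Subcategories
import Literature.AlgebraicGeometry.Frobenioids.CharacteristicSplitting
import HarnessLib

/-!
# Frobenioids I, §2: base-sections, Frobenius-sections, unit-profinite type, unit-wise Frobenius functors II (Def. 2.7, Def. 2.8 (i), Prop. 2.9)

Mochizuki, *The geometry of Frobenioids I*, Kyushu J. Math. **62** (2008), §2, kurims pp. 51–55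
[cite: MochizukiFrdI2008, Def. 2.7 p.51].  Standing data: a Frobenioid `F : C ⥤ ElemFrobenioid Φ`
(of isotropic type for Def. 2.7).

* **Def. 2.7 (i)** a *base-section* `P ⊆ C^pl-bk ⊆ C`: a subcategory with (a) `P` a skeleton,
  (b) every object of `P` Frobenius-trivial, (c) `P → D` an equivalence; *`P`-distinguished* arrows.
  **(ii)** a *[`P`-]Frobenius-section* `F : ℕ_{≥1} → End(P ↪ C)`, a homomorphism with (a) Frobenius
  degree of `F(n)` equal to `n` and (b) values base-identity endomorphisms of Frobenius type;
  *quasi-Frobenius-sections*; *`F`-distinguished* endomorphisms.  **(iii)** *base-Frobenius pairs*,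
  *quasi-base-Frobenius pairs*; `C` is *of pre-model type* if it admits one.
* **Rmk. 2.7.1** expository.  **Rmk. 2.7.2** (statements): only identities are both `F`- and
  `P`-distinguished; for `C` base-trivial and a skeleton, every arrow factors uniquely (strictly) as
  `α ∘ β ∘ γ` with `α` `P`-distinguished, `β` a base-identity pre-step endomorphism, `γ` `F`-distinguished.
* **Def. 2.8 (i)** `C` is *of unit-profinite type* if every `O^×(A)` admits a (unique) topologically
  finitely generated profinite topology (`ProfiniteUnits.lean` for (ii), (iii)).
* **Prop. 2.9** (statements; `C` Frobenius-normalized, base-trivial, isotropic [and `Aut`-ample —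
  superfluous by Rmk. 2.9.2 / Thm. 5.1 (iii)]): (i) if `D` has a terminal object, `C` is of pre-model
  type; (ii) for a characteristic splitting `τ` and `ζ : Primes → ℕ_{≥1}`, if `C` is of pre-model and
  unit-profinite type there is a *unit-wise Frobenius functor* `Ψ : C → C` with (a)–(d).
  **Rmk. 2.9.1** expository; **Rmk. 2.9.2** as a statement.

**Rendering.** A subcategory `P` that is neither full nor wide is a pair (object predicate, arrow
predicate) closed under identities and composition (`Presection`, `Subcategories.lean`), with its
category `P.Cat` and the functors `P.Cat ⥤ C`, `P.Cat ⥤ D`; `End(P ↪ C)` is `End` of the inclusion functor in `P.Cat ⥤ C`.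
"The Frobenius degree of `ε ∈ End(P ↪ C)`" is read componentwise (its independence of the object
is recorded as a statement).  Diagrammatic composition.
-/

noncomputable section

namespace Literature.AlgebraicGeometry.Frobenioids

open CategoryTheory Opposite

universe w v v' u u'

/-- The composite `P ↪ C → D` of a subcategory `P` of a pre-Frobenioid. [cite: MochizukiFrdI2008, Def. 2.7(i) p.51] -/
def Presection.toBase {D : Type u} [Category.{v} D] {Φ : Dᵒᵖ ⥤ CommMonCat.{w}} {C : Type u'}
    [Category.{v'} C] (P : Presection C) (F : C ⥤ ElemFrobenioid Φ) : P.Cat ⥤ D :=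
  P.ι ⋙ PreFrobenioid.baseFunctor F

namespace PreFrobenioid

variable {D : Type u} [Category.{v} D] {Φ : Dᵒᵖ ⥤ CommMonCat.{w}}
  {C : Type u'} [Category.{v'} C] (F : C ⥤ ElemFrobenioid Φ)

/-! ### Definition 2.7 -/

/-- **Def. 2.7 (i)**: a *base-section* of `C` is a subcategory `P ⊆ C^pl-bk ⊆ C` such that (a) `P` is
a skeleton, (b) every object of `P` is Frobenius-trivial, (c) `P ↪ C → D` is an equivalence of
categories. [cite: MochizukiFrdI2008, Def. 2.7(i) p.51] -/
structure IsBaseSection (P : Presection C) : Prop where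
  /-- `P ⊆ C^pl-bk` -/
  hom_pullback : ∀ {A B : C} (f : A ⟶ B), P.hom f → IsPullbackMorphism F f
  /-- (a) `P` is a skeleton -/
  isSkeleton : P.IsSkeleton
  /-- (b) objects of `P` are Frobenius-trivial -/
  isFrobeniusTrivial : ∀ A : C, P.obj A → IsFrobeniusTrivial F A
  /-- (c) `P → D` is an equivalence -/
  isEquivalence : (P.toBase F).IsEquivalence

/-- The *`P`-distinguished* morphisms of `C`: those lying in `P` (Def. 2.7 (i)).
[cite: MochizukiFrdI2008, Def. 2.7(i) p.51] -/
def IsDistinguished (P : Presection C) {A B : C} (f : A ⟶ B) : Prop := P.hom f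

/-- Def. 2.7 (ii), preliminary claim (statement): for `ε ∈ End(P ↪ C)` the Frobenius degree of the
component `ε_A` is independent of the object `A` of `P` ("since `P` is connected").
[cite: MochizukiFrdI2008, Def. 2.7(ii) p.51] -/
def EndDegFrIndependent (P : Presection C) : Prop :=
  IsFrobenioid F → IsBaseSection F P →
    ∀ (ε : End P.ι) (A B : P.Cat), degFr F (ε.app A) = degFr F (ε.app B)

/-- **Def. 2.7 (ii)**: a *`P`-Frobenius-section* of `C`: a homomorphism of monoids
`F : ℕ_{≥1} → End(P ↪ C)` such that (a) the Frobenius degree of `F(n)` is `n` and (b) the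
endomorphisms `F(n)_A` are base-identity endomorphisms of Frobenius type.
[cite: MochizukiFrdI2008, Def. 2.7(ii) p.51] -/
structure IsFrobeniusSection (P : Presection C) (Fr : ℕ+ →* End P.ι) : Prop where
  /-- (a) `deg_Fr ∘ F = id` (componentwise) -/
  degFr_eq : ∀ (n : ℕ+) (A : P.Cat), degFr F ((Fr n).app A) = n
  /-- (b) the components are base-identity … -/
  isBaseIdentity : ∀ (n : ℕ+) (A : P.Cat), IsBaseIdentity F ((Fr n).app A)
  /-- … endomorphisms of Frobenius type -/
  isFrobeniusType : ∀ (n : ℕ+) (A : P.Cat), IsFrobeniusType F ((Fr n).app A)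

/-- A *quasi-Frobenius-section*: a Frobenius-section "regarded as being known only up to composition
with automorphisms of the monoid `ℕ_{≥1}`" — the corresponding equivalence relation.
[cite: MochizukiFrdI2008, Def. 2.7(ii) p.51] -/
def QuasiEqFrobeniusSection (P : Presection C) (Fr Fr' : ℕ+ →* End P.ι) : Prop :=
  ∃ σ : ℕ+ ≃* ℕ+, Fr' = Fr.comp σ.toMonoidHom

/-- The *`F`-distinguished* endomorphisms of `C`: those induced by elements of `End(P ↪ C)` in the
image of `F` (Def. 2.7 (ii)). [cite: MochizukiFrdI2008, Def. 2.7(ii) p.51] -/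
def IsFDistinguished (P : Presection C) (Fr : ℕ+ →* End P.ι) {A : C} (φ : A ⟶ A) : Prop :=
  ∃ (hA : P.obj A) (n : ℕ+), (Fr n).app ⟨A, hA⟩ = φ

/-- **Def. 2.7 (iii)**: a *base-Frobenius pair* `(P, F)` of `C`. [cite: MochizukiFrdI2008, Def. 2.7(iii) p.52] -/
structure IsBaseFrobeniusPair (P : Presection C) (Fr : ℕ+ →* End P.ι) : Prop where
  /-- `P` is a base-section -/
  isBaseSection : IsBaseSection F P
  /-- `F` is a `P`-Frobenius-section -/
  isFrobeniusSection : IsFrobeniusSection F P Fr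

/-- **Def. 2.7 (iii)**: `C` is *of pre-model type* if it admits a base-Frobenius pair
"[or, equivalently, a quasi-base-Frobenius pair]". [cite: MochizukiFrdI2008, Def. 2.7(iii) p.52] -/
def IsOfPreModelType : Prop := ∃ (P : Presection C) (Fr : ℕ+ →* End P.ι), IsBaseFrobeniusPair F P Fr

/-! ### Remark 2.7.2 (statements) -/

/-- **Rmk. 2.7.2**, first claim: for `C` of isotropic type and a base-Frobenius pair `(P, F)`, "the
only arrows of `C` which are both `F`- and `P`-distinguished are the identity arrows".
[cite: MochizukiFrdI2008, Rem. 2.7.2 p.52] -/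
def DistinguishedBothIffId (P : Presection C) (Fr : ℕ+ →* End P.ι) : Prop :=
  IsFrobenioid F → IsOfIsotropicType F → IsBaseFrobeniusPair F P Fr →
    ∀ {A : C} (φ : A ⟶ A), IsDistinguished P φ → IsFDistinguished P Fr φ → φ = 𝟙 A

/-- **Rmk. 2.7.2**, second claim: if moreover `C` is of base-trivial type and the category `C` is a
skeleton, every morphism `φ` factors as `φ = α ∘ β ∘ γ` with `α` `P`-distinguished, `β` a
base-identity pre-step endomorphism and `γ` `F`-distinguished, uniquely "in the strict sense".
[cite: MochizukiFrdI2008, Rem. 2.7.2 p.52] -/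
def DistinguishedFactorization (P : Presection C) (Fr : ℕ+ →* End P.ι) : Prop :=
  IsFrobenioid F → IsOfIsotropicType F → IsBaseFrobeniusPair F P Fr → IsOfType (IsBaseTrivial F) →
    Skeletal C →
      ∀ {A B : C} (φ : A ⟶ B), ∃! t : (A ⟶ A) × (A ⟶ A) × (A ⟶ B),
        t.1 ≫ t.2.1 ≫ t.2.2 = φ ∧ IsFDistinguished P Fr t.1 ∧
          (IsBaseIdentity F t.2.1 ∧ IsPreStep F t.2.1) ∧ IsDistinguished P t.2.2

/-! ### Definition 2.8 (i): unit-profinite type -/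

/-- In a Frobenioid `O^×(A)` is commutative (Remark 1.3.1, via `O^▷(A)`).
[cite: MochizukiFrdI2008, Rem. 1.3.1 p.25] -/
theorem unitsSubgroup_comm (hF : IsFrobenioid F) {A : C} (a b : unitsSubgroup F A) : a * b = b * a := by
  have h := endSubmonoid_comm F hF (⟨(a.1.hom : End A), a.2⟩ : endSubmonoid F A) ⟨(b.1.hom : End A), b.2⟩
  have h' : b.1.hom ≫ a.1.hom = a.1.hom ≫ b.1.hom := congrArg Subtype.val h
  exact Subtype.ext (Iso.ext h')

/-- `O^×(A)` as a commutative group (Remark 1.3.1), the structure needed to speak of its pro-`l`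
portions (Def. 2.8 (ii)). [cite: MochizukiFrdI2008, Def. 2.8(i) p.52] -/
@[reducible] def unitsCommGroup (hF : IsFrobenioid F) (A : C) : CommGroup (unitsSubgroup F A) :=
  { (inferInstance : Group (unitsSubgroup F A)) with mul_comm := unitsSubgroup_comm F hF }

/-- **Def. 2.8 (i)**: `C` is *of unit-profinite type* if every `O^×(A)` admits a profinite topology
for which it is a topologically finitely generated profinite [abelian] group.
[cite: MochizukiFrdI2008, Def. 2.8(i) p.52] -/
def IsOfUnitProfiniteType : Prop := ∀ A : C, AdmitsTfgProfiniteTopology (unitsSubgroup F A)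

/-! ### Proposition 2.9 and Remarks 2.9.1, 2.9.2 (statements) -/

/-- **Prop. 2.9 (i)** (statement): for `C` of Frobenius-normalized, base-trivial, isotropic and
`Aut`-ample type, "if the base category `D` admits a terminal object, then `C` is of pre-model type".
[cite: MochizukiFrdI2008, Prop. 2.9(i) p.53] -/
def PreModelOfTerminal : Prop :=
  IsFrobenioid F → IsOfType (IsFrobeniusNormalized F) → IsOfType (IsBaseTrivial F) →
    IsOfIsotropicType F → IsOfType (IsAutAmple F) → (∃ T : D, IsTerminalObj T) → IsOfPreModelType F

/-- **Prop. 2.9 (ii)** (statement): for `C` as in Prop. 2.9 and of pre-model and unit-profinite type,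
a characteristic splitting `τ` and `ζ : Primes → ℕ_{≥1}`, there exists a *unit-wise Frobenius
functor* `Ψ : C → C` [associated to `τ`, `ζ`] with (a) `1`-compatibility with the identity functor
on `F_Φ`, relative to `C → F_Φ`; (b) objects ↦ isomorphic objects, morphisms of Frobenius type /
pre-steps / pull-back morphisms ↦ abstractly equivalent morphisms; (c) for each `A` an isomorphism
`Ψ(A) ≅ A` conjugating `Ψ` on `O^×(A)` into the map "raising to the `ζ`-th power" (for the profinite
topology of `O^×(A)`); (d) `ζ` of co-prime type ⇒ `Ψ` an equivalence, `C` of unit-trivial type ⇒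
`Ψ ≅ id`. [cite: MochizukiFrdI2008, Prop. 2.9(ii) p.53] -/
def UnitWiseFrobeniusZetaExists (ζ : Nat.Primes → ℕ+) : Prop :=
  ∀ (_τ : CharacteristicSplitting F) (hF : IsFrobenioid F), IsOfType (IsFrobeniusNormalized F) →
    IsOfType (IsBaseTrivial F) → IsOfIsotropicType F → IsOfType (IsAutAmple F) →
    IsOfPreModelType F → IsOfUnitProfiniteType F →
      ∃ Ψ : C ⥤ C,
        OneCommutes Ψ F F (𝟭 (ElemFrobenioid Φ)) ∧
        (∀ A : C, Nonempty (Ψ.obj A ≅ A)) ∧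
        (∀ {A B : C} (φ : A ⟶ B),
          (IsFrobeniusType F φ ∨ IsPreStep F φ ∨ IsPullbackMorphism F φ) →
            IsAbstractlyEquivalent (Ψ.map φ) φ) ∧
        (∀ A : C, ∃ (e : Ψ.obj A ≅ A) (t : TopologicalSpace (unitsSubgroup F A))
          (f : unitsSubgroup F A → unitsSubgroup F A),
            @IsTfgProfinite _ _ t ∧ @IsZetaPowerMap _ (unitsCommGroup F hF A) t ζ f ∧
              ∀ u : unitsSubgroup F A, e.inv ≫ Ψ.map u.1.hom ≫ e.hom = (f u).1.hom) ∧
        (IsOfCoprimeType ζ → Ψ.IsEquivalence) ∧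
        (IsOfType (IsUnitTrivial F) → Nonempty (Ψ ≅ 𝟭 C))

/-- **Rmk. 2.9.2** (statement): "the `Aut`-ampleness hypothesis in the statement of Proposition 2.9
is superfluous" — a Frobenioid of Frobenius-normalized, base-trivial and isotropic type is of
`Aut`-ample type [cf. Theorem 5.1 (iii)]. [cite: MochizukiFrdI2008, Rem. 2.9.2 p.55] -/
def AutAmpleSuperfluous : Prop :=
  IsFrobenioid F → IsOfType (IsFrobeniusNormalized F) → IsOfType (IsBaseTrivial F) →
    IsOfIsotropicType F → IsOfType (IsAutAmple F)

end PreFrobenioid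

end Literature.AlgebraicGeometry.Frobenioids
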